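import Literature.Computability.Cryptography.LWEHardness
import Literature.Computability.Cryptography.LWESearchToDecisionTest
import Literature.Computability.Complexity.TruthTableClosure
import HarnessLib

/-!
# Search-to-decision for LWE (Regev 2009, §1/§4): the reduction, modulo its machine and a noise estimate

Regev (2009, §1, p. 4 of the arXiv version) records that distinguishing LWE samples from uniform is
"seemingly easier" than, and equivalent to, solving search LWE; the easy direction — a search solver
yields a distinguisher — is the folklore *residual test* analysed in `LWESearchToDecisionTest.lean`.
Here we assemble the statement `regev_search_to_decision` (`LWEHardness.lean`, pqc.S22) from

* the probability estimates of the residual test (`LWE.toOuterMeasure_accepts_uniform_le`,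
  `LWE.le_toOuterMeasure_accepts_lwe`);
* the shape of the distinguishing machine: the one-query truth-table oracle algorithm `ttAlg Q 1 D`
  of `TruthTableClosure.lean` (polynomial-time as soon as `Q ∈ FP`, `D ∈ P`: `isPolyTime_ttAlg`),
  run with no coins and two rounds; its output law is a point mass (`oracleLWEDistinguisher_ttAlg`);

leaving as explicit HYPOTHESES of the assembled theorem `regev_search_to_decision_of_machine` the two
remaining ingredients, each proved in its own file:

* `hmach` — the existence of a query map `Q ∈ FP` re-encoding the last `m` of `C q² + m` samples
  (`IsS2DQueryMap`; a suffix of the coded sample list, so that `Q` is a projection) and of a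
  verdict language `D ∈ P` deciding the residual test on the first `C q²` samples against the
  decoded oracle answer (`IsS2DVerdict`): a programming exercise in the tree's TM2/`FP` toolkit;
* `hgauss` — the noise estimate `Ψ̄_α(0) ≥ (1 + 1/k)/q` for `α ∈ (0,1)`, `q ≥ 2` (the discretised
  Gaussian is bounded away from uniform at `0`, uniformly in `α < 1`), an analytic fact about
  `LWE.discretizedGaussian`.

With `T = C q²` test samples, `k ≥ 1` and `C ≥ 10 k²` the advantage is `≥ (2/3)(1 - k²/C) - k²/C ≥ 1/2`
for all large `n`, whence `DecisionLWEDistinguishes … (1/n)`.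

## References

* O. Regev, *On lattices, learning with errors, random linear codes, and cryptography*, J. ACM 56
  (2009), §1 (p. 4), §4 [RegevLWE2009].
* R. E. Ladner, N. A. Lynch, A. L. Selman, *A comparison of polynomial time reducibilities*,
  Theoret. Comput. Sci. 1 (1975), §3 (truth-table reductions) [LadnerLynchSelman1975].
-/

noncomputable section

open scoped ENNReal
open Filter Polynomial Literature.Computability.Complexity Literature.Computability.Cryptography.LWE

namespace Literature.Computability.Cryptography

open _root_.Computability

/-! ### The two machine-level specifications -/

/-- `IsS2DQueryMap C Q`: on the (paired, coin-extended) code of `C q² + m` LWE samples, the string map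
`Q` returns the code of the last `m` samples — the query of the search-to-decision reduction.
[cite: RegevLWE2009, §1 (p. 4) and §4] -/
def IsS2DQueryMap (C : ℕ) (Q : List Bool → List Bool) : Prop :=
  ∀ (n q m : ℕ), 0 < q → ∀ (S : Fin (C * q ^ 2 + m) → (Fin n → ZMod q) × ZMod q) (r : List Bool),
    Q (boolPair (boolPair (encodeLWESamples S) r) []) =
      encodeLWESamples (fun i : Fin m => S (Fin.natAdd (C * q ^ 2) i))

/-- `IsS2DVerdict C k D`: on the code of `C q² + m` LWE samples paired with an oracle answer `a`, the
language `D` holds iff the residual test with parameter `k` accepts the first `C q²` samples against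
the secret `decodeSecret n q a` — the verdict of the search-to-decision reduction.
[cite: RegevLWE2009, §1 (p. 4) and §4] -/
def IsS2DVerdict (C k : ℕ) (D : Language Bool) : Prop :=
  ∀ (n q m : ℕ), 0 < q → ∀ (S : Fin (C * q ^ 2 + m) → (Fin n → ZMod q) × ZMod q) (r a : List Bool),
    boolPair (boolPair (encodeLWESamples S) r) a ∈ D ↔
      LWE.Accepts k (C * q ^ 2) (decodeSecret n q a) (fun j => S (Fin.castAdd m j))

/-! ### The one-query truth-table machine, run without coins -/

/-- The run of the one-query truth-table algorithm `ttAlg Q 1 D` with two rounds: ask `Q ⟨z, ε⟩`,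
then output `[⟨z, answer⟩ ∈ D]`. [cite: LadnerLynchSelman1975, §3] -/
theorem run_ttAlg_one (Q : List Bool → List Bool) (D : Language Bool) (O : Oracle) (z : List Bool) :
    (ttAlg Q 1 D).run O 2 z = some (D.boolIndicator (boolPair z (O (Q (boolPair z []))))) := by
  rw [OracleAlg.run, OracleAlg.runAux_succ, ttAlg_step_of_lt z (by simp)]
  simp only [List.length_nil, List.replicate_zero, List.nil_append]
  rw [OracleAlg.runAux_succ, ttAlg_step_of_le z (by simp)]
  simp

/-- With no coins the randomised run is the deterministic run on `⟨x, ε⟩`. [folklore] -/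
theorem randRun_zero_coins {β : Type} (M : OracleAlg β) (O : Oracle) (fuel : Polynomial ℕ)
    (x : List Bool) :
    M.randRun O 0 fuel x = PMF.pure (M.run O (fuel.eval x.length) (boolPair x [])) := by
  rw [OracleAlg.randRun_eq_map]
  have hconst : (fun r : List.Vector Bool ((0 : Polynomial ℕ).eval x.length) =>
      M.run O (fuel.eval x.length) (boolPair x r.toList)) =
      Function.const _ (M.run O (fuel.eval x.length) (boolPair x [])) := by
    funext r
    have hr : r.toList = [] := List.eq_nil_of_length_eq_zero (by simp)
    rw [hr]
    rfl
  rw [hconst, PMF.map_const]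

/-- **The distinguisher is deterministic.** Run with no coins and two rounds on `m'` samples `S`, the
one-query truth-table machine `ttAlg Q 1 D` yields the point mass at the verdict
`[⟨⟨code S, ε⟩, O(Q ⟨⟨code S, ε⟩, ε⟩)⟩ ∈ D]`. [cite: LadnerLynchSelman1975, §3] -/
theorem oracleLWEDistinguisher_ttAlg (Q : List Bool → List Bool) (D : Language Bool) (O : Oracle)
    (n q m' : ℕ) (S : Fin m' → (Fin n → ZMod q) × ZMod q) :
    oracleLWEDistinguisher (ttAlg Q 1 D) O 0 2 n q m' S =
      PMF.pure (D.boolIndicator (boolPair (boolPair (encodeLWESamples S) [])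
        (O (Q (boolPair (boolPair (encodeLWESamples S) []) []))))) := by
  rw [oracleLWEDistinguisher, randRun_zero_coins]
  simp only [eval_ofNat]
  rw [run_ttAlg_one, PMF.pure_map]
  rfl

/-- The acceptance probability of a deterministic distinguisher is the mass of its acceptance set.
[folklore] -/
theorem acceptProb_pure {β : Type} (b : β → Bool) (P : PMF β) :
    acceptProb (fun x => PMF.pure (b x)) P = P.toOuterMeasure {x | b x = true} := by
  rw [acceptProb, show (fun x => PMF.pure (b x)) = PMF.pure ∘ b from rfl, PMF.bind_pure_comp,
    ← PMF.toOuterMeasure_apply_singleton, PMF.toOuterMeasure_map_apply]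
  rfl

/-! ### Assembly -/

/-- Polynomial bounds are closed under `m ↦ C q² + m`. [folklore] -/
theorem isPolyBounded_mul_sq_add {m q : ℕ → ℕ} (hm : IsPolyBounded m) (hq : IsPolyBounded q) (C : ℕ) :
    IsPolyBounded fun n => C * q n ^ 2 + m n := by
  obtain ⟨pm, hpm⟩ := hm
  obtain ⟨pq, hpq⟩ := hq
  refine ⟨(C : Polynomial ℕ) * pq ^ 2 + pm, fun n => ?_⟩
  rw [eval_add, eval_mul, eval_natCast, eval_pow]
  exact Nat.add_le_add (Nat.mul_le_mul_left C (Nat.pow_le_pow_left (hpq n) 2)) (hpm n)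

/-- **Search ⇒ decision for LWE (Regev 2009, §1/§4), assembled.** Given (`hmach`) a polynomial-time
query map and verdict language realising the residual test with `C q²` test samples and parameter
`k ≥ 1`, `C ≥ 10 k²`, and (`hgauss`) the noise estimate `Ψ̄_α(0) ≥ (1 + 1/k)/q` for `α ∈ (0,1)`,
`q ≥ 2`, the statement `regev_search_to_decision q` holds: the machine is `ttAlg Q 1 D` with no coins,
two rounds, `m' = C q² + m` samples and advantage exponent `c = 1`.  On LWE samples it accepts with
probability `≥ (2/3)(1 - k²/C)` (`le_toOuterMeasure_accepts_lwe` and the solver's success `≥ 2/3`), on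
uniform samples with probability `≤ k²/C` (`toOuterMeasure_accepts_uniform_le`), so the advantage is
`≥ 1/2 ≥ 1/n` for `n ≥ 2`. [cite: RegevLWE2009, §1 (p. 4) and §4] -/
theorem regev_search_to_decision_of_machine (q : ℕ → ℕ) [∀ n, NeZero (q n)] {k C : ℕ} (hk : 0 < k)
    (hC : 10 * k ^ 2 ≤ C)
    (hgauss : ∀ (q₀ : ℕ) [NeZero q₀] (α₀ : ℝ), 2 ≤ q₀ → 0 < α₀ → α₀ < 1 →
      (1 + 1 / (k : ℝ)) / q₀ ≤ (discretizedGaussian q₀ α₀ 0).toReal)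
    (hmach : ∃ (Q : List Bool → List Bool) (D : Language Bool),
      Q ∈ FP ∧ D ∈ Classes.P ∧ IsS2DQueryMap C Q ∧ IsS2DVerdict C k D) :
    regev_search_to_decision q := by
  intro α m hq hq2 hm hα
  obtain ⟨Q, D, hQ, hD, hQspec, hDspec⟩ := hmach
  refine ⟨ttAlg Q 1 D, 0, 2, fun n => C * q n ^ 2 + m n, 1, isPolyTime_ttAlg hQ hD,
    isPolyBounded_mul_sq_add hm hq C, fun O hO => ?_⟩
  rw [Oracle.solvesSearchLWE_iff] at hO
  unfold DecisionLWEDistinguishes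
  filter_upwards [hO, hq2, hα, eventually_ge_atTop 2] with n hsucc hqn hαn hn
  -- notation for dimension `n`
  set qn := q n with hqn_def
  set T := C * qn ^ 2 with hT_def
  set χ := discretizedGaussian qn (α n) with hχ_def
  set hsec : (Fin (m n) → (Fin n → ZMod qn) × ZMod qn) → Fin n → ZMod qn :=
    fun S₁ => decodeSecret n qn (O (encodeLWESamples S₁)) with hsec_def
  have hq0 : 0 < qn := by omega
  have hT0 : 0 < T := Nat.mul_pos (by nlinarith) (pow_pos hq0 2)
  -- the distinguisher is the indicator of the acceptance set of the residual test
  have hdist : oracleLWEDistinguisher (ttAlg Q 1 D) O 0 2 n qn (C * qn ^ 2 + m n) =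
      fun S => PMF.pure ((acceptSet k T (m n) hsec).boolIndicator S) := by
    funext S
    rw [oracleLWEDistinguisher_ttAlg, hQspec n qn (m n) hq0 S []]
    congr 1
    rw [Bool.eq_iff_iff, ← Set.mem_iff_boolIndicator, ← Set.mem_iff_boolIndicator, mem_acceptSet]
    exact hDspec n qn (m n) hq0 S [] _
  have hacc : ∀ P : PMF (Fin (C * qn ^ 2 + m n) → (Fin n → ZMod qn) × ZMod qn),
      acceptProb (oracleLWEDistinguisher (ttAlg Q 1 D) O 0 2 n qn (C * qn ^ 2 + m n)) P =
        P.toOuterMeasure (acceptSet k T (m n) hsec) := by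
    intro P
    rw [hdist, acceptProb_pure]
    congr 1
    ext S
    exact (Set.mem_iff_boolIndicator _ _).symm
  -- the two estimates
  set ε : ℝ := (k : ℝ) ^ 2 * (qn : ℝ) ^ 2 / T with hε_def
  have hε : ε = (k : ℝ) ^ 2 / C := by
    rw [hε_def, hT_def, Nat.cast_mul, Nat.cast_pow]
    have : (qn : ℝ) ≠ 0 := by positivity
    have hC0 : (C : ℝ) ≠ 0 := by
      have : 0 < C := lt_of_lt_of_le (by nlinarith) hC
      positivity
    field_simp
  have hε10 : ε ≤ 1 / 10 := by
    rw [hε, div_le_div_iff₀ (by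
      have : 0 < C := lt_of_lt_of_le (by nlinarith) hC
      positivity) (by norm_num)]
    have : ((10 * k ^ 2 : ℕ) : ℝ) ≤ C := by exact_mod_cast hC
    push_cast at this
    linarith
  have hε0 : 0 ≤ ε := by rw [hε]; positivity
  have hχ0 : (1 + 1 / (k : ℝ)) / qn ≤ (χ 0).toReal := hgauss qn (α n) hqn hαn.1 hαn.2
  have hU : (uniformSamples (Fin n) (ZMod qn) (T + m n)).toOuterMeasure (acceptSet k T (m n) hsec) ≤
      ENNReal.ofReal ε :=
    toOuterMeasure_accepts_uniform_le hk hT0 hsec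
  have hL : ENNReal.ofReal (1 - ε) * ENNReal.ofReal (2 / 3) ≤
      (lweSamplesUniformSecret χ (T + m n)).toOuterMeasure (acceptSet k T (m n) hsec) := by
    refine le_trans ?_ (le_toOuterMeasure_accepts_lwe hk hT0 χ hχ0 hsec)
    gcongr
    exact hsucc
  -- pass to real numbers
  have hA1 : (lweSamplesUniformSecret χ (T + m n)).toOuterMeasure (acceptSet k T (m n) hsec) ≠ ∞ :=
    ne_top_of_le_ne_top ENNReal.one_ne_top (by
      rw [← toOuterMeasure_add_compl (lweSamplesUniformSecret χ (T + m n)) (acceptSet k T (m n) hsec)]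
      exact le_self_add)
  have hLr : (1 - ε) * (2 / 3) ≤
      ((lweSamplesUniformSecret χ (T + m n)).toOuterMeasure (acceptSet k T (m n) hsec)).toReal := by
    have := ENNReal.toReal_mono hA1 hL
    rwa [ENNReal.toReal_mul, ENNReal.toReal_ofReal (by linarith), ENNReal.toReal_ofReal (by norm_num)]
      at this
  have hUr : ((uniformSamples (Fin n) (ZMod qn) (T + m n)).toOuterMeasure
      (acceptSet k T (m n) hsec)).toReal ≤ ε := by
    have := ENNReal.toReal_mono ENNReal.ofReal_ne_top hU
    rwa [ENNReal.toReal_ofReal hε0] at this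
  -- conclude
  rw [distinguishingAdvantage, hacc, hacc, pow_one]
  have hn' : (2 : ℝ) ≤ n := by exact_mod_cast hn
  calc 1 / (n : ℝ) ≤ 1 / 2 := one_div_le_one_div_of_le (by norm_num) hn'
    _ ≤ (1 - ε) * (2 / 3) - ε := by nlinarith
    _ ≤ _ := le_trans (sub_le_sub hLr hUr) (le_abs_self _)

end Literature.Computability.Cryptography

end
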